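import Summits.BirchSwinnertonDyer.BirchSwinnertonDyer.Theorems.AdditiveKolyvaginRoadLagrangianSwitchAtP
import Mathlib.RingTheory.Jacobson.Ideal
import HarnessLib

/-!
# Route `AdditiveKolyvaginRoad`: the BOTTOM SWITCH and the UNIT TRANSPORT — the two typed lemmas of crux card `theta-cycle-seed`
# (crux KS′ `LevelKolyvaginSystemsAdditive`, item stmt-BirchSwinnertonDyer-21396; MODULE of the avatar family, triage round 1 PASS)
# (cell `pub/bsd-wall`, width seat `bsd-wall-akr-p2x-w4` g4; `--supports stmt-BirchSwinnertonDyer-21396`, helper)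

THEOREMS ONLY (no definition, no named fact, no `sorry`).  BSD is not proved by any of this; KS′ and KPA′ stay OPEN at `p² ∣ N`;
the card's θ-cycle companion and its log identity (T1) are untouched — only its two CHECKABLE typed statements are proved.

THE POINT.  The crux-ideation card `Cruxes/LevelKolyvaginSystemsAdditive/Ideas/theta-cycle-seed.md` (round 1; triage seat 1 g15:
PASS as a module) types in `Cruxes/…/ThetaCycleSeedSketch.lean` two `def … : Prop` statements «over existing declarations»:

* (T4) `BdpSwitchAtBottom` — **the residual BDP Selmer group dies at a locally primitive rank-one frame**: `E/K` over a number
  field, `p ≠ 2`, the route's Poitou–Tate package DUAL.2 (`poitouTate_selmerStructure_duality K`), two distinct finite places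
  `𝔭 ≠ 𝔭'` with `#H¹(K_𝔭, E[p]) = p²` (a PLANE; `= #H¹(K_{𝔭'}, E[p])`), the `p`-Selmer group `H¹_𝓚(K, E[p])` of order `p` whose
  localisation is injective at `𝔭` and at `𝔭'` ⟹ the Selmer group of `𝓚[𝔭 ↦ ⊤][𝔭' ↦ ⊥]` (E's Kummer conditions off `𝔭, 𝔭'`,
  RELAXED at `𝔭`, STRICT at `𝔭'` — the residual shadow of Castella's ∕ JSW's `Sel_{∅,0}` at the bottom layer) is TRIVIAL.  The
  sketch's «meant proof (M-sized)» is carried out here VERBATIM on the tree's one-place jump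
  `LagrangianSwitchAtP.relIndex_kummerStrict_kummerRelaxed_sq` (width seat akr-p2x-w2 g3): the strict-at-`𝔭` group sits inside
  `H¹_𝓚 ∩ ker loc_𝔭 = 0`, so `[relaxed_𝔭 : strict_𝔭]² = p²` gives `#relaxed_𝔭 = p = #H¹_𝓚`, whence `relaxed_𝔭 = H¹_𝓚` and
  `Sel_{rel 𝔭, str 𝔭'} = ker(loc_{𝔭'} | H¹_𝓚) = 0`.  Proved as `bdpSwitchAtBottom`, with EXACTLY the sketch's binders (the plane
  count at `𝔭'` is carried but idle).
* (T-pin) `UnitTransportModP` — in a commutative ring with `p` in the Jacobson radical, `x − u·y ∈ (p)` with `u` a unit ⟹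
  (`x` unit ⟺ `y` unit).  Proved as `unitTransportModP` (via `isUnit_add_mul_of_mem_jacobson_bot`).

A skeleton on the card closes `ThetaCycleSeed.BdpSwitchAtBottom` and `ThetaCycleSeed.UnitTransportModP` by `exact` from these
(the Cruxes sketch is not importable from `Theorems/`, so the `def`s are restated as theorem TYPES, not re-declared).

References: [JetchevSkinnerWan2017] (3.5.d); [Castella2018] Def. 2.2; [MilneADT2006] Ch. I, Thm. 4.10, Lemma 6.15;
[PoonenRains2012] Prop. 4.11; [McCallumLMS1991] Prop. 2.1.
-/

-- D-0017: single-problem summit, so `Summit.BirchSwinnertonDyer.BirchSwinnertonDyer.…` repeats a namespace BY DESIGN.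
set_option linter.dupNamespace false
set_option autoImplicit false

noncomputable section

open scoped Classical NumberField
open Function NumberField IsDedekindDomain Field WeierstrassCurve
open Literature.NumberTheory.EllipticCurves
open Literature.NumberTheory.GaloisRepresentations Literature.NumberTheory.GaloisRepresentations.DiscreteGaloisModule
  Literature.NumberTheory.GaloisCohomology
open Summit.BirchSwinnertonDyer.Rank1Residual.X11b.FiniteDuality
open Summit.BirchSwinnertonDyer.Rank1Residual.X11b.Relaxation
open Summit.BirchSwinnertonDyer.Rank1Residual.X11b.LocBridge
open Summit.BirchSwinnertonDyer.Rank1Residual.X11b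
open Summit.BirchSwinnertonDyer.Rank1Residual.X11b.KummerPT
open Summit.BirchSwinnertonDyer.BirchSwinnertonDyer.Theorems.AdditiveKoly.LagrangianSwitchAtP

namespace Summit.BirchSwinnertonDyer.BirchSwinnertonDyer.Theorems.AdditiveKoly.ThetaCycleSeed

/-! ## §1 (T-pin) Unit transport along a congruence modulo an element of the Jacobson radical -/

section UnitTransport

variable {R : Type*} [CommRing R]

/-- A unit plus a multiple of an element of the Jacobson radical is a unit: `a` unit, `j ∈ J(R)` ⟹ `a + j·r` unit
(`a + j r = a · (1 + j · a⁻¹ r)`). [folklore] -/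
theorem isUnit_add_mul_of_mem_jacobson_bot {j : R} (hj : j ∈ Ideal.jacobson (⊥ : Ideal R)) {a : R} (ha : IsUnit a)
    (r : R) : IsUnit (a + j * r) := by
  obtain ⟨a, rfl⟩ := ha
  have h1 : IsUnit (j * (↑a⁻¹ * r) + 1) := Ideal.mem_jacobson_bot.mp hj _
  have heq : (↑a : R) * (j * (↑a⁻¹ * r) + 1) = ↑a + j * r := by
    calc (↑a : R) * (j * (↑a⁻¹ * r) + 1) = j * ((↑a : R) * ↑a⁻¹) * r + ↑a := by ring
      _ = ↑a + j * r := by rw [Units.mul_inv]; ring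
  rw [← heq]
  exact (Units.isUnit a).mul h1

/-- **(T-pin) `UnitTransportModP` of crux card `theta-cycle-seed` (tree form, same binders).**  In a commutative ring `R` with
`p ∈ J(R)` (the Jacobson radical of `0`; meant: `ℤ_p^{ur}` or `𝒪_𝔭` of a Hecke field), if `x − u·y ∈ (p)` with `u` a unit, then
`x` is a unit iff `y` is — the one-line algebra under the θ-cycle log identity (T1) (`x = log_{ω_E}(y_K)/c`, `y` = the CM-value sum,
`u` = the Euler factors where the two Selmer structures differ). [folklore] -/
theorem unitTransportModP (R : Type) [CommRing R] (p : R) (hp : p ∈ Ideal.jacobson (⊥ : Ideal R))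
    (x y u : R) (hu : IsUnit u) (hxy : x - u * y ∈ Ideal.span {p}) : IsUnit x ↔ IsUnit y := by
  obtain ⟨r, hr⟩ := Ideal.mem_span_singleton.mp hxy
  have hx : x = u * y + p * r := by linear_combination hr
  constructor
  · intro hxU
    have huy : IsUnit (u * y) := by
      have h : u * y = x + p * (-r) := by linear_combination -hr
      rw [h]
      exact isUnit_add_mul_of_mem_jacobson_bot hp hxU (-r)
    exact isUnit_of_mul_isUnit_right huy
  · intro hyU
    rw [hx]
    exact isUnit_add_mul_of_mem_jacobson_bot hp (hu.mul hyU) r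

end UnitTransport

/-! ## §2 (T4) The bottom switch: the residual (relaxed at `𝔭`, strict at `𝔭'`) Selmer group of `E[p]` vanishes -/

section BottomSwitch

/-- **(T4) `BdpSwitchAtBottom` of crux card `theta-cycle-seed` — the residual BDP Selmer group dies at a locally primitive
rank-one frame (tree form, EXACTLY the sketch's binders).**  `E = W` an elliptic curve over a number field `K`, `p ≠ 2`, the
Poitou–Tate package DUAL.2 of the route (`poitouTate_selmerStructure_duality K`), two DISTINCT finite places `𝔭 ≠ 𝔭'` at each of
which `H¹(K_v, E[p])` is a plane (`#H¹ = p²`; meant: the two primes above a split `p` with `E(K_v)[p] = 0`, by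
`LagrangianSwitchAtP.natCard_localH1_eq_sq`).  HYPOTHESES on the frame: the `p`-Selmer group `H¹_𝓚(K, E[p])` has order `p` and
its localisation is INJECTIVE at `𝔭` and at `𝔭'`.  CONCLUSION: the Selmer group of `𝓚[𝔭 ↦ ⊤][𝔭' ↦ ⊥]` (E's Kummer conditions off
`𝔭, 𝔭'`, relaxed at `𝔭`, strict at `𝔭'`) is trivial (`Nat.card = 1`).  Proof: the strict-at-`𝔭` group lies in `H¹_𝓚 ∩ ker loc_𝔭 = 0`;
the JUMP `[relaxed_𝔭 : strict_𝔭]² = #H¹(K_𝔭, E[p]) = p²` (`relIndex_kummerStrict_kummerRelaxed_sq`, from DUAL.2) gives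
`#relaxed_𝔭 = p = #H¹_𝓚`, so `relaxed_𝔭 = H¹_𝓚` (`H¹_𝓚 ≤ relaxed_𝔭`); the target group is `relaxed_𝔭 ∩ ker loc_{𝔭'} =
H¹_𝓚 ∩ ker loc_{𝔭'} = 0`.  The mod-`p` form of Jetchev–Skinner–Wan's `#Sel_{∅,0} = #Ш·[E(K_𝔭̄) : loc E(K)]²` at `Ш[p] = 0`; the
plane count at `𝔭'` is carried (sketch binder) but not used.  CONDITIONAL on DUAL.2 only.
[cite: JetchevSkinnerWan2017, (3.5.d)] [cite: MilneADT2006, Ch. I, Thm. 4.10, Lemma 6.15] [cite: PoonenRains2012, Prop. 4.11] -/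
theorem bdpSwitchAtBottom (K : Type) [Field K] [NumberField K] (W : WeierstrassCurve K) [W.IsElliptic] (p : ℕ) [Fact p.Prime]
    (𝔭 𝔭' : HeightOneSpectrum (𝓞 K))
    (hp2 : p ≠ 2) (hPT : poitouTate_selmerStructure_duality K) (hne : 𝔭 ≠ 𝔭')
    (h𝔭 : Nat.card (galoisCohomology ((W.torsionGaloisModule ((p ^ 1 : ℕ) : ℤ)).toLocal (Sum.inr 𝔭 : Place K)) 1) = p ^ 2)
    (_h𝔭' : Nat.card (galoisCohomology ((W.torsionGaloisModule ((p ^ 1 : ℕ) : ℤ)).toLocal (Sum.inr 𝔭' : Place K)) 1) = p ^ 2)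
    (hSel : Nat.card (W.kummerSelmerStructure ((p ^ 1 : ℕ) : ℤ)).selmerGroup = p)
    (hinj : ∀ x ∈ (W.kummerSelmerStructure ((p ^ 1 : ℕ) : ℤ)).selmerGroup,
      galoisCohomology.localization (W.torsionGaloisModule ((p ^ 1 : ℕ) : ℤ)) (Sum.inr 𝔭 : Place K) 1 x = 0 → x = 0)
    (hinj' : ∀ x ∈ (W.kummerSelmerStructure ((p ^ 1 : ℕ) : ℤ)).selmerGroup,
      galoisCohomology.localization (W.torsionGaloisModule ((p ^ 1 : ℕ) : ℤ)) (Sum.inr 𝔭' : Place K) 1 x = 0 → x = 0) :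
    Nat.card (SelmerStructure.selmerGroup
      (Function.update (Function.update (W.kummerSelmerStructure ((p ^ 1 : ℕ) : ℤ)) (Sum.inr 𝔭 : Place K) ⊤)
        (Sum.inr 𝔭' : Place K) ⊥ : SelmerStructure (W.torsionGaloisModule ((p ^ 1 : ℕ) : ℤ)))) = 1 := by
  have hp : p.Prime := Fact.out
  haveI : NeZero (p ^ 1 : ℕ) := ⟨pow_ne_zero 1 hp.ne_zero⟩
  obtain ⟨inv, hperf, hsum, -, hcompl⟩ := hPT (p ^ 1)
  have hv𝔭 : (Sum.inr 𝔭 : Place K) ∈ ({(Sum.inr 𝔭 : Place K)} : Finset (Place K)) := Finset.mem_singleton_self _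
  -- `H¹_𝓚 ≤ relaxed_𝔭`
  have hSelR : (W.kummerSelmerStructure ((p ^ 1 : ℕ) : ℤ)).selmerGroup ≤
      (kummerRelaxed W (p ^ 1) {(Sum.inr 𝔭 : Place K)}).selmerGroup := fun x hx ↦ by
    rw [SelmerStructure.mem_selmerGroup_iff] at hx ⊢
    intro v
    by_cases hv : v ∈ ({(Sum.inr 𝔭 : Place K)} : Finset (Place K))
    · rw [kummerRelaxed_of_mem W (p ^ 1) _ hv]; exact AddSubgroup.mem_top _
    · rw [kummerRelaxed_of_not_mem W (p ^ 1) _ hv]; exact hx v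
  -- `strict_𝔭 = 0`: it lies in `H¹_𝓚 ∩ ker loc_𝔭`
  have hS₀ : (kummerStrict W (p ^ 1) {(Sum.inr 𝔭 : Place K)}).selmerGroup = ⊥ := by
    rw [eq_bot_iff]
    intro x hx
    have hx' := (SelmerStructure.mem_selmerGroup_iff _ _).mp hx
    have hxSel : x ∈ (W.kummerSelmerStructure ((p ^ 1 : ℕ) : ℤ)).selmerGroup := by
      rw [SelmerStructure.mem_selmerGroup_iff]
      intro v
      by_cases hv : v ∈ ({(Sum.inr 𝔭 : Place K)} : Finset (Place K))
      · have h := hx' v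
        rw [kummerStrict_of_mem W (p ^ 1) _ hv] at h
        rw [(AddSubgroup.mem_bot).mp h]
        exact AddSubgroup.zero_mem _
      · have h := hx' v
        rwa [kummerStrict_of_not_mem W (p ^ 1) _ hv] at h
    have h0 : galoisCohomology.localization (W.torsionGaloisModule ((p ^ 1 : ℕ) : ℤ)) (Sum.inr 𝔭 : Place K) 1 x = 0 := by
      have h := hx' (Sum.inr 𝔭)
      rw [kummerStrict_of_mem W (p ^ 1) _ hv𝔭] at h
      exact (AddSubgroup.mem_bot).mp h
    exact (AddSubgroup.mem_bot).mpr (hinj x hxSel h0)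
  -- the jump `[relaxed_𝔭 : strict_𝔭]² = #H¹(K_𝔭, E[p]) = p²`, so `#relaxed_𝔭 = p`
  have hjump := relIndex_kummerStrict_kummerRelaxed_sq W p inv hp2 hperf hsum hcompl 𝔭
  rw [h𝔭] at hjump
  have hidx : (kummerStrict W (p ^ 1) {(Sum.inr 𝔭 : Place K)}).selmerGroup.relIndex
      (kummerRelaxed W (p ^ 1) {(Sum.inr 𝔭 : Place K)}).selmerGroup = p :=
    Nat.pow_left_injective two_ne_zero hjump
  have hR : Nat.card (kummerRelaxed W (p ^ 1) {(Sum.inr 𝔭 : Place K)}).selmerGroup = p := by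
    have h := AddSubgroup.relIndex_bot_left (kummerRelaxed W (p ^ 1) {(Sum.inr 𝔭 : Place K)}).selmerGroup
    rw [← hS₀, hidx] at h
    exact h.symm
  -- `H¹_𝓚 = relaxed_𝔭` (inclusion of groups of the same prime order)
  haveI : Finite (kummerRelaxed W (p ^ 1) {(Sum.inr 𝔭 : Place K)}).selmerGroup :=
    Nat.finite_of_card_ne_zero (by rw [hR]; exact hp.ne_zero)
  have hSelEq : (W.kummerSelmerStructure ((p ^ 1 : ℕ) : ℤ)).selmerGroup =
      (kummerRelaxed W (p ^ 1) {(Sum.inr 𝔭 : Place K)}).selmerGroup :=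
    AddSubgroup.eq_of_le_of_card_ge hSelR (by rw [hR, hSel])
  -- the target group is `relaxed_𝔭 ∩ ker loc_{𝔭'}`
  have hne' : (Sum.inr 𝔭' : Place K) ≠ Sum.inr 𝔭 := fun h ↦ hne (Sum.inr_injective h).symm
  have htarget : SelmerStructure.selmerGroup
      (Function.update (Function.update (W.kummerSelmerStructure ((p ^ 1 : ℕ) : ℤ)) (Sum.inr 𝔭 : Place K) ⊤)
        (Sum.inr 𝔭' : Place K) ⊥ : SelmerStructure (W.torsionGaloisModule ((p ^ 1 : ℕ) : ℤ))) =
      (kummerRelaxed W (p ^ 1) {(Sum.inr 𝔭 : Place K)}).selmerGroup ⊓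
        (galoisCohomology.localization (W.torsionGaloisModule ((p ^ 1 : ℕ) : ℤ)) (Sum.inr 𝔭' : Place K) 1).ker := by
    ext x
    simp only [AddSubgroup.mem_inf, AddMonoidHom.mem_ker, SelmerStructure.mem_selmerGroup_iff]
    constructor
    · intro h
      refine ⟨fun v ↦ ?_, ?_⟩
      · by_cases hv : v ∈ ({(Sum.inr 𝔭 : Place K)} : Finset (Place K))
        · rw [kummerRelaxed_of_mem W (p ^ 1) _ hv]; exact AddSubgroup.mem_top _
        · rw [kummerRelaxed_of_not_mem W (p ^ 1) _ hv]
          have hv1 : v ≠ Sum.inr 𝔭 := fun h' ↦ hv (h' ▸ Finset.mem_singleton_self _)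
          by_cases hv2 : v = Sum.inr 𝔭'
          · subst hv2
            have h' := h (Sum.inr 𝔭')
            rw [Function.update_self] at h'
            rw [(AddSubgroup.mem_bot).mp h']
            exact AddSubgroup.zero_mem _
          · have h' := h v
            rwa [Function.update_of_ne hv2, Function.update_of_ne hv1] at h'
      · have h' := h (Sum.inr 𝔭')
        rw [Function.update_self] at h'
        exact (AddSubgroup.mem_bot).mp h'
    · rintro ⟨hxR, hx0⟩ v
      by_cases hv2 : v = Sum.inr 𝔭'
      · subst hv2
        rw [Function.update_self]
        exact (AddSubgroup.mem_bot).mpr hx0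
      · rw [Function.update_of_ne hv2]
        by_cases hv1 : v = Sum.inr 𝔭
        · subst hv1
          rw [Function.update_self]
          exact AddSubgroup.mem_top _
        · rw [Function.update_of_ne hv1]
          have h' := hxR v
          rwa [kummerRelaxed_of_not_mem W (p ^ 1) _ (fun h'' ↦ hv1 (Finset.mem_singleton.mp h''))] at h'
  -- `H¹_𝓚 ∩ ker loc_{𝔭'} = 0` by injectivity at `𝔭'`
  have hbot : (W.kummerSelmerStructure ((p ^ 1 : ℕ) : ℤ)).selmerGroup ⊓
      (galoisCohomology.localization (W.torsionGaloisModule ((p ^ 1 : ℕ) : ℤ)) (Sum.inr 𝔭' : Place K) 1).ker = ⊥ := by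
    rw [eq_bot_iff]
    rintro x ⟨hx, hx0⟩
    exact (AddSubgroup.mem_bot).mpr (hinj' x hx hx0)
  rw [htarget, ← hSelEq, hbot, AddSubgroup.card_bot]

end BottomSwitch

end Summit.BirchSwinnertonDyer.BirchSwinnertonDyer.Theorems.AdditiveKoly.ThetaCycleSeed

end
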